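import Literature.InformationTheory.QuantumCodes.GoodQLDPC
import Literature.InformationTheory.QuantumCodes.CSS
import HarnessLib

/-!
# Lemmas about the `w`-limited CSS parameter predicates of `GoodQLDPC.lean`

Companion to `Literature/InformationTheory/QuantumCodes/GoodQLDPC.lean` (QEC ladder PARTITION row
type-07), which is statements-only. Here: the unfolding of the distance clause
`⌈D⌉ ≤ cssMinDist H_X H_Z` into "every nontrivial logical representative has weight `≥ D`" and back
(`IsQLDPCCodeWith.le_hammingNorm`, `ceil_le_cssMinDist_of_forall_le_hammingNorm`), monotonicity
of `IsQLDPCCodeWith` / `IsQLDPCFamily` in the locality and the two bounds, and two PRIVATE sanity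
checks recording that, as typed (pure existence), `PanteleevKalachev2022_good_qldpc` over `𝔽₂`
implies `DinurHsiehLinVidick2022_good_qldpc` and `LeverrierZemor2022_quantumTanner` (the latter by
monotonicity in `Δ`: a `w`-limited pair is `Δ²`-limited once `Δ ≥ w`, and `δ/(4Δ^{3/2+ε}) ≤ c` once
`Δ ≥ δ/(4c)`). None of this is mathematics of the cited papers; the public lemmas cite the printed
DEFINITIONS they unfold (Panteleev–Kalachev 2022 §1: `ω`-limited, `k`, `d = min(d_X,d_Z)`).
-/

namespace Literature.InformationTheory.QuantumCodes

open Matrix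

/-! ### Elementary relations between the typed statements (proved; none of the papers' mathematics) -/

section Relations

variable {F : Type*} [Field F] [DecidableEq F] {RX RZ Q : Type*} [Fintype RX] [Fintype RZ]
  [Fintype Q] {HX : Matrix RX Q F} {HZ : Matrix RZ Q F} {w w' : ℕ} {K K' D D' : ℝ}

/-- Unfolding the distance clause: every vector of `ker H_X ∖ rs H_Z` and every vector of
`ker H_Z ∖ rs H_X` (every nontrivial logical representative) has Hamming weight `≥ D` — the
printed meaning of "`d ≥ D`". [cite: PanteleevKalachev2022, §1 (arXiv:2111.03654 chunk p0003 L14 and L17–23: the printed definitions of `ω`-limited, `k` and `d = min(d_X, d_Z)` that the predicate packages)] -/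
theorem IsQLDPCCodeWith.le_hammingNorm (h : IsQLDPCCodeWith HX HZ w K D) {e : Q → F}
    (he : (e ∈ pcCode HX ∧ e ∉ rowSpace HZ) ∨ (e ∈ pcCode HZ ∧ e ∉ rowSpace HX)) :
    D ≤ hammingNorm e := by
  have h1 : (⌈D⌉₊ : ℕ∞) ≤ (hammingNorm e : ℕ∞) :=
    h.ceil_le_cssMinDist.trans (cssMinDist_le_hammingNorm he)
  exact Nat.ceil_le.1 (by exact_mod_cast h1)

/-- Conversely, a real lower bound on the weight of every nontrivial logical representative gives the
distance clause `⌈D⌉ ≤ cssMinDist H_X H_Z`. [cite: PanteleevKalachev2022, §1 (arXiv:2111.03654 chunk p0003 L14 and L17–23: the printed definitions of `ω`-limited, `k` and `d = min(d_X, d_Z)` that the predicate packages)] -/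
theorem ceil_le_cssMinDist_of_forall_le_hammingNorm
    (h : ∀ e : Q → F, (e ∈ pcCode HX ∧ e ∉ rowSpace HZ) ∨ (e ∈ pcCode HZ ∧ e ∉ rowSpace HX) →
      D ≤ hammingNorm e) :
    (⌈D⌉₊ : ℕ∞) ≤ cssMinDist HX HZ :=
  le_cssMinDist_iff.2 fun e he => by exact_mod_cast Nat.ceil_le.2 (h e he)

/-- Monotonicity of the parameter predicate: a `w`-limited CSS pair with `k ≥ K`, `d ≥ D` is
`w'`-limited with `k ≥ K'`, `d ≥ D'` whenever `w ≤ w'`, `K' ≤ K`, `D' ≤ D` (immediate from the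
printed definitions). [cite: PanteleevKalachev2022, §1 (arXiv:2111.03654 chunk p0003 L14 and L17–23: the printed definitions of `ω`-limited, `k` and `d = min(d_X, d_Z)` that the predicate packages)] -/
theorem IsQLDPCCodeWith.mono (h : IsQLDPCCodeWith HX HZ w K D) (hw : w ≤ w') (hK : K' ≤ K)
    (hD : D' ≤ D) : IsQLDPCCodeWith HX HZ w' K' D' where
  comm := h.comm
  rowX_le i := (h.rowX_le i).trans hw
  colX_le j := (h.colX_le j).trans hw
  rowZ_le i := (h.rowZ_le i).trans hw
  colZ_le j := (h.colZ_le j).trans hw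
  le_dim := hK.trans h.le_dim
  ceil_le_cssMinDist :=
    le_trans (by exact_mod_cast Nat.ceil_mono hD) h.ceil_le_cssMinDist

end Relations

/-- Monotonicity of the family predicate in the locality and in the two rates (immediate from the
printed definitions). [cite: PanteleevKalachev2022, §1 (arXiv:2111.03654 chunk p0003 L14 and L17–23: the printed definitions of `ω`-limited, `k` and `d = min(d_X, d_Z)` that the predicate packages)] -/
theorem IsQLDPCFamily.mono {F : Type*} [Field F] [DecidableEq F] {w w' : ℕ} {R R' δ δ' : ℝ}
    (h : IsQLDPCFamily F w R δ) (hw : w ≤ w') (hR : R' ≤ R) (hδ : δ' ≤ δ) :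
    IsQLDPCFamily F w' R' δ' := by
  intro N
  obtain ⟨n, hn, mX, mZ, HX, HZ, hcode⟩ := h N
  have hn0 : (0 : ℝ) ≤ n := by positivity
  exact ⟨n, hn, mX, mZ, HX, HZ, hcode.mono hw (mul_le_mul_of_nonneg_right hR hn0)
    (mul_le_mul_of_nonneg_right hδ hn0)⟩

/-- As typed (pure existence; explicitness and decoders dropped), the Dinur–Hsieh–Lin–Vidick
statement is the binary case of the Panteleev–Kalachev statement: `𝔽_q := 𝔽₂`, `R := r`.
(A relation between the TYPED statements only; the printed theorems differ in their algorithmic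
content. PRIVATE: a sanity check on the quantifier structure, not a published statement.)
[folklore] -/
private theorem dinurHsiehLinVidick2022_of_panteleevKalachev2022
    (h : PanteleevKalachev2022_good_qldpc) : DinurHsiehLinVidick2022_good_qldpc := by
  intro r hr0 hr1
  obtain ⟨w, c, hc, hfam⟩ := h (ZMod 2) r hr0 (by linarith)
  exact ⟨c, w, hc, hfam⟩

/-- As typed, the Leverrier–Zémor statement follows from the Panteleev–Kalachev statement over
`𝔽₂` with `R := (1-2ρ)²`: both bounds of the former are monotone in `Δ` (a `w`-limited pair is
`Δ²`-limited once `Δ ≥ w`, and `δ/(4Δ^{3/2+ε}) ≤ c` once `Δ ≥ δ/(4c)`), which is exactly why "for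
every `Δ ≥ Δ₀`" carries no more than existence at one large degree (docstring of
`LeverrierZemor2022_quantumTanner`). (A relation between the TYPED statements only. PRIVATE: a
sanity check on the quantifier structure, not a published statement.) [folklore] -/
private theorem leverrierZemor2022_quantumTanner_of_panteleevKalachev2022
    (h : PanteleevKalachev2022_good_qldpc) : LeverrierZemor2022_quantumTanner := by
  intro ρ ε δ hρ0 hρ1 hε0 _hε1 hδ _hδ1 _hent
  have hR0 : 0 < (1 - 2 * ρ) ^ 2 := by
    have : 0 < 1 - 2 * ρ := by linarith
    positivity
  have hR1 : (1 - 2 * ρ) ^ 2 < 1 := by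
    have h1 : 0 < 1 - 2 * ρ := by linarith
    have h2 : 1 - 2 * ρ < 1 := by linarith
    nlinarith
  obtain ⟨w, c, hc, hfam⟩ := h (ZMod 2) ((1 - 2 * ρ) ^ 2) hR0 hR1
  -- `Δ₀ := max (w+1) (⌈δ / (4c)⌉₊ + 1)`
  refine ⟨max (w + 1) (⌈δ / (4 * c)⌉₊ + 1), by positivity, fun Δ hΔ => hfam.mono ?_ le_rfl ?_⟩
  · -- `w ≤ Δ ≤ Δ²`
    have hwΔ : w ≤ Δ := by
      have := le_max_left (w + 1) (⌈δ / (4 * c)⌉₊ + 1); omega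
    calc w ≤ Δ := hwΔ
      _ ≤ Δ ^ 2 := Nat.le_self_pow two_ne_zero Δ
  · -- `δ /(4 Δ^{3/2+ε}) ≤ c` since `Δ^{3/2+ε} ≥ Δ ≥ δ/(4c)`
    have hΔ1 : (1 : ℝ) ≤ Δ := by
      have : 1 ≤ Δ := le_trans (by omega) hΔ
      exact_mod_cast this
    have hΔge : δ / (4 * c) ≤ Δ := by
      have h1 : ⌈δ / (4 * c)⌉₊ + 1 ≤ Δ := le_trans (le_max_right _ _) hΔ
      have h2 : (⌈δ / (4 * c)⌉₊ : ℝ) + 1 ≤ Δ := by exact_mod_cast h1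
      linarith [Nat.le_ceil (δ / (4 * c))]
    have hpow : (Δ : ℝ) ≤ (Δ : ℝ) ^ ((3 : ℝ) / 2 + ε) :=
      Real.self_le_rpow_of_one_le hΔ1 (by linarith)
    have hden : δ / (4 * c) ≤ (Δ : ℝ) ^ ((3 : ℝ) / 2 + ε) := hΔge.trans hpow
    have hδ : δ ≤ c * (4 * (Δ : ℝ) ^ ((3 : ℝ) / 2 + ε)) := by
      have := (div_le_iff₀ (by positivity : (0 : ℝ) < 4 * c)).1 hden
      linarith
    exact (div_le_iff₀ (by positivity)).2 hδ


/-! ### Binary case: the parameters of the `CSSCode` (`QuantumCodes/CSS.lean`) of an `IsQLDPCCodeWith` pair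

Appended 2026-08-26 (qec row type-07): for `F = 𝔽₂` the pair `(H_X, H_Z)` of `IsQLDPCCodeWith H_X H_Z w K D`
presents the `CSSCode.ofMatrices H_X H_Z _` of `CSS.lean` (row type-02), and the two real bounds transfer to
ITS `k`, `dX`, `dZ`: `K ≤ k` (`CSSCode.k_eq`: `k = n − rank H^X − rank H^Z`) and, when `k > 0`, `D ≤ dX`,
`D ≤ dZ` (`CSSCode.cssMinDist_eq_min_dX_dZ`) — so the named facts of `GoodQLDPC.lean` speak about the same
objects as the census files. No new definitions. -/

section Binary

variable {RX RZ Q : Type*} [Fintype RX] [Fintype RZ] [Fintype Q]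
  {HX : Matrix RX Q (ZMod 2)} {HZ : Matrix RZ Q (ZMod 2)} {w : ℕ} {K D : ℝ}

/-- Dimension transfer: `K ≤ k` for the `CSSCode` dimension `k = dim ker H^Z − dim rs H^X`
(`= n − rank H^X − rank H^Z`, `CSSCode.k_eq`) of the binary CSS code presented by `(H_X, H_Z)`.
[cite: PanteleevKalachev2022, §1 (arXiv:2111.03654 chunk p0003 L17–23: "k = dim C_X/C_Z^⊥", "the condition C_Z^⊥ ⊆ C_X is equivalent to H_X H_Z^T = 0")] -/
theorem IsQLDPCCodeWith.le_k (h : IsQLDPCCodeWith HX HZ w K D) :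
    K ≤ ((CSSCode.ofMatrices HX HZ h.comm).k : ℝ) := by
  have hk : (CSSCode.ofMatrices HX HZ h.comm).k = Fintype.card Q - HX.rank - HZ.rank :=
    CSSCode.k_eq _
  have hle : HX.rank + HZ.rank ≤ Fintype.card Q := CSSCode.rank_HX_add_rank_HZ_le ⟨HX, HZ, h.comm⟩
  have hcast : (((CSSCode.ofMatrices HX HZ h.comm).k : ℕ) : ℝ) =
      (Fintype.card Q : ℝ) - HX.rank - HZ.rank := by
    rw [hk, Nat.cast_sub (by omega), Nat.cast_sub (by omega)]
  rw [hcast]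
  exact h.le_dim

/-- Distance transfer, `X` side: if the code has a logical qubit (`k > 0`) then `D ≤ d^X`
(`d^X = min {|v| : v ∈ ker H^Z ∖ rs H^X}` of `CSS.lean`). [cite: PanteleevKalachev2022, §1 (arXiv:2111.03654 chunk p0003 L17–23: "Its minimum distance d is defined as min(d_X, d_Z)")] -/
theorem IsQLDPCCodeWith.le_dX (h : IsQLDPCCodeWith HX HZ w K D)
    (hk : 0 < (CSSCode.ofMatrices HX HZ h.comm).k) :
    D ≤ ((CSSCode.ofMatrices HX HZ h.comm).dX : ℝ) := by
  have hmin : cssMinDist HX HZ =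
      ((min (CSSCode.ofMatrices HX HZ h.comm).dX (CSSCode.ofMatrices HX HZ h.comm).dZ : ℕ) : ℕ∞) :=
    CSSCode.cssMinDist_eq_min_dX_dZ (CSSCode.ofMatrices HX HZ h.comm) hk
  have h1 := h.ceil_le_cssMinDist
  rw [hmin] at h1
  have h2 : ⌈D⌉₊ ≤ (CSSCode.ofMatrices HX HZ h.comm).dX :=
    (by exact_mod_cast h1 : ⌈D⌉₊ ≤ _).trans (min_le_left _ _)
  exact Nat.ceil_le.1 h2

/-- Distance transfer, `Z` side: if `k > 0` then `D ≤ d^Z`. [cite: PanteleevKalachev2022, §1 (arXiv:2111.03654 chunk p0003 L17–23)] -/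
theorem IsQLDPCCodeWith.le_dZ (h : IsQLDPCCodeWith HX HZ w K D)
    (hk : 0 < (CSSCode.ofMatrices HX HZ h.comm).k) :
    D ≤ ((CSSCode.ofMatrices HX HZ h.comm).dZ : ℝ) := by
  have hmin : cssMinDist HX HZ =
      ((min (CSSCode.ofMatrices HX HZ h.comm).dX (CSSCode.ofMatrices HX HZ h.comm).dZ : ℕ) : ℕ∞) :=
    CSSCode.cssMinDist_eq_min_dX_dZ (CSSCode.ofMatrices HX HZ h.comm) hk
  have h1 := h.ceil_le_cssMinDist
  rw [hmin] at h1
  have h2 : ⌈D⌉₊ ≤ (CSSCode.ofMatrices HX HZ h.comm).dZ :=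
    (by exact_mod_cast h1 : ⌈D⌉₊ ≤ _).trans (min_le_right _ _)
  exact Nat.ceil_le.1 h2

/-- A positive dimension bound forces a logical qubit: `0 < K → 0 < k` (so the distance transfers
apply along every family with `R > 0`, `n ≥ 1`). [cite: PanteleevKalachev2022, §1 (arXiv:2111.03654 chunk p0003 L17–23)] -/
theorem IsQLDPCCodeWith.k_pos (h : IsQLDPCCodeWith HX HZ w K D) (hK : 0 < K) :
    0 < (CSSCode.ofMatrices HX HZ h.comm).k := by
  have := hK.trans_le h.le_k
  exact_mod_cast this

end Binary

end Literature.InformationTheory.QuantumCodes
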